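import Summits.BirchSwinnertonDyer.BirchSwinnertonDyer.Theorems.KolyvaginRankRigidityAtTwoStartFrameEigenframe
import Summits.BirchSwinnertonDyer.BirchSwinnertonDyer.Theorems.KolyvaginRankRigidityAtTwoStartFrameEigenRank
import Summits.BirchSwinnertonDyer.BirchSwinnertonDyer.Theorems.KolyvaginRankRigidityAtTwoStartFrameDictionary
import Summits.BirchSwinnertonDyer.BirchSwinnertonDyer.Theorems.KolyvaginRankRigidityAtTwoWalkBridge
import Summits.BirchSwinnertonDyer.BirchSwinnertonDyer.Theorems.KolyvaginRankRigidityAtTwoWalkFrameAlgebra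
import Summits.BirchSwinnertonDyer.BirchSwinnertonDyer.Theorems.GenusKolyvaginAtTwoCasselsTatePTcRealReadout
import Literature.NumberTheory.EllipticCurves.CasselsTateAlternating
import Literature.NumberTheory.EllipticCurves.ZpCorankStable
import Literature.NumberTheory.EllipticCurves.BSDSelmerParityMonskyProofs
import Literature.NumberTheory.EllipticCurves.TwoSelmerRankQuadraticParity
import Literature.NumberTheory.EllipticCurves.HeegnerPointsImaginaryQuadraticProofs
import Literature.NumberTheory.EllipticCurves.BSDSelmerParityDokchitserBaseChangeProofs
import Literature.NumberTheory.EllipticCurves.SelmerGaloisAction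
import Literature.NumberTheory.EllipticCurves.KummerSelmerStructure
import Literature.NumberTheory.EllipticCurves.PointDivisibilityProofs
import HarnessLib

/-!
# Crux U1 `KolyvaginBoundedDefectAtTwo` (stmt-BirchSwinnertonDyer-28083), LINE 17 `regular_core_rigidity`,
# stub S1b — THE START FRAME FROM 2-PARITY OVER `K` (N3‴ discharged modulo print)

Width seat `bsd-line-krr2-p2` g16 (ONE READER on S1b); `--supports stmt-BirchSwinnertonDyer-28083` (helper).
THEOREMS ONLY; CONDITIONAL on the tree's named fact `Monsky1996_lemma14b_twoSelmerRank_parity` (Monsky 1996 L.1.4(b) =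
Kramer 1981 Thm. 1, print, unproved in the tree); nothing here proves S1b outright, U1, a rung or BSD. BSD is NOT proved.

`startFrameAtTwo_of_twoSelmerParity h14`: the conclusion is VERBATIM the hypothesis `hSF` (the START FRAME) of
`RegularWalk.nearCoreExistenceAtTwo_of_startFrame` (`…WalkNearCore`, p700395), so S1b follows modulo `h14` by composition
(file `…StartFrameNearCore`). Construction (plan `Cruxes/KolyvaginBoundedDefectAtTwo/S1-READER-g15.md`, Addendum B), on U1's
habitat and for `τ ∈ Gal(K/ℚ)`, `τ ≠ 1`:
* `S = Sel_{2^∞}(E/K)` is `2`-primary with finite `S[2]`; `C = 2^{k₀} S` is its maximal divisible subgroup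
  (`exists_torsionBy_inf_range_stable`, `exists_nsmul_eq_of_stable`) and `2^{corank S} = #(S[2] ∩ C)`
  (`pow_zpCorank_eq_natCard_torsionBy_inf_range_of_stable`);
* complex conjugation `τ_*` (`IsLiftOfAut.conjH1Primary`) preserves `S` and is an involution — both read off the finite levels
  through the dictionary `Sel^(2^n) → S` (`exists_mem_selmerGroup_torsionPowToPrimaryH1_eq`, `conjH1Primary_torsionPowToPrimaryH1_conjAct`,
  `conjAct_mem_selmerGroup`, `conjAct_conjAct_of_mul_self`);
* the eigenframe algebra (`EigenframeFinite.eigenframe_of_divisible_finite_card`) gives level-free ranks `r₊, r₋` and, at every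
  level `2^k`, eigenclasses `e ⊆ C₊[2^k]`, `f ⊆ C₋[2^k]` of exact order `2^k`, jointly independent with LOSS ONE, with
  `2·C[2^k] ⊆ span`; and `#(C ∩ S[2]) = 2^{r₋} · 2^{r₊}` (`natCard_inf_torsionBy_two_eq_mul_of_involution`), so `m := r₊ + r₋ = corank S`;
* `m` is ODD: `corank S ≡ rank E(K) + dim Ш(E/K)[2]` (Cassels–Tate, `mordellWeilRank_add_mod_two_eq_selmerCorank_of_casselsTate` fed
  by the tree theorem `WeierstrassCurve.exists_casselsTate_pairing_holds`, composed inline from its route-independent inputs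
  `exists_casselsTate_pairing_of_levelThetaDatum` + `levelThetaDatumEven`) `≡ r₂(K) = 1` (`h14`, `IsImaginaryQuadratic.nrComplexPlaces_eq_one`);
* descend to `H¹(K, E[2^k])` by the injective (`E(K)[2] = 0`) equivariant dictionary: the frame `g = T_k⁻¹(e, f)` lies in
  `Sel^(2^k)(E/K) = H_{𝓕(1)}` (`Jetchev2008.modifiedSelmerGroup_one`), has signs `(+1,…,+1,−1,…,−1)`, exact order `2^k`,
  (F3) with `J = k₀ + 1` (`2^{k₀} u ∈ C[2^k]`, then `2·` lands in the span) and (F4) with `d = 2` (loss one + Sah at `2`,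
  `two_zsmul_eq_zero_of_res_eq_zero`).
[cite: Greenberg1999, §1–2] [cite: GrossLMS1991, §5 (5.1), §9 Prop. 9.1] [cite: Monsky1996, Lemma 1.4(b)] [cite: Kramer1981, Thm. 1]
[cite: Cassels1962ArithmeticIV, §1]
Design: no definitions; `K : Type`; axioms `propext`, `Classical.choice`, `Quot.sound`.
-/

set_option autoImplicit false
-- the Theorems namespace of this sub repeats the summit name by design (D-0017 nested layout)
set_option linter.dupNamespace false

noncomputable section

open scoped Classical AddSubgroup
open Function NumberField WeierstrassCurve Field Finset
open Literature.NumberTheory.EllipticCurves Literature.NumberTheory.EllipticCurves.KolyvaginPairing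
open Literature.NumberTheory.GaloisRepresentations
open Summit.BirchSwinnertonDyer.BirchSwinnertonDyer.Theorems.KolyvaginAtTwo.EigenframeFinite

namespace Summit.BirchSwinnertonDyer.BirchSwinnertonDyer.Theorems.KolyvaginAtTwo.RegularWalk

/-! ### §1 Small algebra -/

/-- `∑ over Fin (m + n)` of an appended coefficient vector against an appended family. [folklore] -/
theorem sf_sum_append {G : Type*} [AddCommGroup G] {m n : ℕ} (a : Fin m → ℤ) (b : Fin n → ℤ)
    (e : Fin m → G) (f : Fin n → G) :
    ∑ i, Fin.append a b i • Fin.append e f i = ∑ i, a i • e i + ∑ j, b j • f j := by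
  rw [Fin.sum_univ_add]
  simp only [Fin.append_left, Fin.append_right]

/-- `∑ over Fin (m + n)` of any coefficient vector against an appended family. [folklore] -/
theorem sf_sum_append' {G : Type*} [AddCommGroup G] {m n : ℕ} (c : Fin (m + n) → ℤ)
    (e : Fin m → G) (f : Fin n → G) :
    ∑ i, c i • Fin.append e f i = ∑ i, c (Fin.castAdd n i) • e i + ∑ j, c (Fin.natAdd m j) • f j := by
  rw [Fin.sum_univ_add]
  simp only [Fin.append_left, Fin.append_right]

/-- `(2^j : ℕ) • x = (2 : ℤ)^j • x`. [folklore] -/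
theorem sf_pow_nsmul_eq_zsmul {G : Type*} [AddCommGroup G] (j : ℕ) (x : G) :
    (2 ^ j : ℕ) • x = (2 : ℤ) ^ j • x := by
  rw [← natCast_zsmul, Nat.cast_pow, Nat.cast_ofNat]

/-- The `2`-parity input in corank form: on U1's habitat `corank_{ℤ₂} Sel_{2^∞}(E/K)` is ODD, granted `h14`
(Cassels–Tate is a tree theorem). [cite: Monsky1996, Lemma 1.4(b)] [cite: Kramer1981, Thm. 1] [cite: Cassels1962ArithmeticIV, §1] -/
theorem selmerCorank_two_odd_of_twoSelmerParity (h14 : Monsky1996_lemma14b_twoSelmerRank_parity)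
    (W : WeierstrassCurve ℚ) [W.IsElliptic] {K : Type} [Field K] [NumberField K] (hK : IsImaginaryQuadratic K)
    (hH : SatisfiesHeegnerHypothesis (W.conductorNorm ℤ) K) (hH2 : SatisfiesHeegnerHypothesis 2 K) :
    (W.baseChange K).selmerCorank 2 % 2 = 1 := by
  haveI : (W.baseChange K).IsElliptic := inferInstanceAs ((W.map (algebraMap ℚ K)).IsElliptic)
  haveI : Fact (Nat.Prime 2) := ⟨Nat.prime_two⟩
  obtain ⟨u, hu⟩ := exists_natCard_shaTorsionBy_eq_pow (W.baseChange K) 2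
  -- the Cassels–Tate theorem over `K` (tree theorem `WeierstrassCurve.exists_casselsTate_pairing_holds`, composed here from
  -- its two route-independent inputs so that this file stays out of every route cone)
  have hCT := mordellWeilRank_add_mod_two_eq_selmerCorank_of_casselsTate
    (GenusExact.CasselsTatePTcReal.exists_casselsTate_pairing_of_levelThetaDatum (K := K)
      fun V _ k hk _ e hμ hadd₁ hadd₂ _hgal halt _hnd =>
        ⟨levelThetaDatumEven V (2 ^ k) e hμ hadd₁ hadd₂ halt (Nat.even_pow.mpr ⟨even_two, hk.ne'⟩)⟩)
    (W.baseChange K) 2 hu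
  have hu' : Nat.card (((W.baseChange K).sha)[(2 : ℤ)]) = 2 ^ u := by exact_mod_cast hu
  have h := h14 W K hK.1 hH2 hH u hu'
  rw [IsImaginaryQuadratic.nrComplexPlaces_eq_one hK] at h
  rw [← hCT, h]

/-! ### §2 The start frame -/

set_option maxHeartbeats 1600000 in
/-- **THE START FRAME of `Sel_{2^k}(E/K)` on U1's habitat, from 2-parity over `K`** (`h14`): VERBATIM the hypothesis of
`nearCoreExistenceAtTwo_of_startFrame`. See the module docstring for the construction. [cite: Greenberg1999, §1–2]
[cite: GrossLMS1991, §5 (5.1), §9 Prop. 9.1] [cite: Monsky1996, Lemma 1.4(b)] [cite: Kramer1981, Thm. 1] -/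
theorem startFrameAtTwo_of_twoSelmerParity (h14 : Monsky1996_lemma14b_twoSelmerRank_parity) :
    ∀ (W : WeierstrassCurve ℚ) [W.IsElliptic] [W.IsGloballyMinimal], ¬ W.HasCM → (Literature.NumberTheory.EllipticCurves.Rank1Residual.GoodOrd W 2 ∨ Literature.NumberTheory.EllipticCurves.Rank1Residual.Mult W 2) → (∀ m : ℕ, W.HasSurjectiveModNGaloisRep (2 ^ m : ℕ)) → ∀ (K : Type) [Field K] [NumberField K], Literature.NumberTheory.EllipticCurves.IsImaginaryQuadratic K → ∀ [NeZero (W.conductorNorm ℤ)], Literature.NumberTheory.EllipticCurves.SatisfiesHeegnerHypothesis (W.conductorNorm ℤ) K → Odd (NumberField.discr K) → NumberField.discr K ≠ -3 → AddSubgroup.torsionBy (W.baseChange K).toAffine.Point (2 : ℤ) = ⊥ → Literature.NumberTheory.EllipticCurves.SatisfiesHeegnerHypothesis 2 K → ∀ (Dt : Literature.NumberTheory.EllipticCurves.ModularForms.ModularParametrizationData W (W.conductorNorm ℤ)) (β : ℤ) (ι : K →+* ℂ) [∀ k : ℕ, NumberField (ringClassField K ι k)], (4 * (W.conductorNorm ℤ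 : ℤ)) ∣ β ^ 2 - NumberField.discr K → ∀ (τ : K ≃ₐ[ℚ] K), τ ≠ 1 →
      ∃ (m : ℕ) (sg : Fin m → ℤ) (i₀ : Fin m) (J d : ℕ), Odd m ∧ (∀ i, sg i = 1 ∨ sg i = -1) ∧
        ∀ k : ℕ, 1 ≤ k → ∃ g : Fin m → galH1Torsion (W.baseChange K) ((2 ^ k : ℕ) : ℤ),
          (∀ i, g i ∈ Jetchev2008.modifiedSelmerGroup W K ι ((2 ^ k : ℕ) : ℤ) 1) ∧
          (∀ i, conjAct W τ ((2 ^ k : ℕ) : ℤ) (g i) = sg i • g i) ∧ addOrderOf (g i₀) = 2 ^ k ∧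
          (∀ u : galH1Torsion (W.baseChange K) ((2 ^ k : ℕ) : ℤ),
            u ∈ Jetchev2008.modifiedSelmerGroup W K ι ((2 ^ k : ℕ) : ℤ) 1 → ∃ b : Fin m → ℤ,
              ∀ ρ ∈ torsionFixing (W.baseChange K) ((2 ^ (k + 1) : ℕ) : ℤ),
                h1Eval (W.baseChange K) ((2 ^ k : ℕ) : ℤ) (((2 : ℤ) ^ J) • u - ∑ i, b i • g i) ρ = 0) ∧
          (∀ b : Fin m → ℤ, (∀ ρ ∈ torsionFixing (W.baseChange K) ((2 ^ (k + 1) : ℕ) : ℤ),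
              h1Eval (W.baseChange K) ((2 ^ k : ℕ) : ℤ) (∑ i, b i • g i) ρ = 0) → ∀ i, (2 : ℤ) ^ (k - d) ∣ b i) := by
  intro W _ _ _hCM _hred hsur K _ _ hK _ hH _hodd _hd3 htors hH2 _Dt _β ι _ _hβ τ _hτ1
  classical
  haveI : (W.baseChange K).IsElliptic := inferInstanceAs ((W.map (algebraMap ℚ K)).IsElliptic)
  haveI : Fact (Nat.Prime 2) := ⟨Nat.prime_two⟩
  -- notation
  set S : AddSubgroup (galH1Primary (W.baseChange K) 2) := selmerGroupPInfty (W.baseChange K) 2 with hSdef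
  have hdiv : (W.baseChange K).zsmul_geomPoints_surjective := (W.baseChange K).zsmul_geomPoints_surjective_holds
  have htors' : AddSubgroup.torsionBy (W.baseChange K).toAffine.Point ((2 : ℕ) : ℤ) = ⊥ := by exact_mod_cast htors
  have hinj : ∀ n : ℕ, Injective (torsionPowToPrimaryH1 (W.baseChange K) 2 n) := fun n ↦
    torsionPowToPrimaryH1_injective_of_torsionBy_eq_bot (W.baseChange K) 2 n htors'
  have hKc : ∀ w : InfinitePlace K, w.IsComplex := fun w ↦ hK.2.isComplex w
  have hττ : τ * τ = 1 := by
    haveI : Algebra.IsQuadraticExtension ℚ K := ⟨hK.1⟩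
    have hcard : Nat.card (K ≃ₐ[ℚ] K) = 2 := by rw [IsGalois.card_aut_eq_finrank, hK.1]
    haveI : Finite (K ≃ₐ[ℚ] K) := Nat.finite_of_card_ne_zero (by rw [hcard]; decide)
    have := pow_card_eq_one' (G := K ≃ₐ[ℚ] K) (x := τ)
    rwa [hcard, pow_two] at this
  -- `S` is `2`-primary with finite `2`-torsion
  have hA2 : ∀ a : S, ∃ n : ℕ, 2 ^ n • a = 0 := fun a ↦ by
    obtain ⟨n, hn⟩ := exists_pow_nsmul_eq_zero_galH1Primary (W.baseChange K) 2 (a : galH1Primary (W.baseChange K) 2)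
    exact ⟨n, Subtype.ext (by rw [AddSubmonoidClass.coe_nsmul, hn, ZeroMemClass.coe_zero])⟩
  haveI hfinT : Finite (S[((2 : ℕ) : ℤ)]) := finite_torsionBy_selmerGroupPInfty (W.baseChange K) 2
  -- every element of `S` comes from a finite level
  have hlift : ∀ s : S, ∃ (n : ℕ) (y : galH1Torsion (W.baseChange K) ((2 ^ n : ℕ) : ℤ)),
      y ∈ selmerGroup (W.baseChange K) ((2 ^ n : ℕ) : ℤ) ∧
        torsionPowToPrimaryH1 (W.baseChange K) 2 n y = (s : galH1Primary (W.baseChange K) 2) := fun s ↦ by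
    obtain ⟨n, hn⟩ := exists_pow_nsmul_eq_zero_galH1Primary (W.baseChange K) 2 (s : galH1Primary (W.baseChange K) 2)
    obtain ⟨y, hy, hys⟩ := exists_mem_selmerGroup_torsionPowToPrimaryH1_eq (W.baseChange K) 2 n hdiv s.2 hn
    exact ⟨n, y, hy, hys⟩
  -- complex conjugation on `S`
  have hmemS : ∀ s : S, (isLiftOfAut_liftAut τ).conjH1Primary W 2 (s : galH1Primary (W.baseChange K) 2) ∈ S := by
    intro s
    obtain ⟨n, y, hy, hys⟩ := hlift s
    rw [← hys, conjH1Primary_torsionPowToPrimaryH1_conjAct]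
    exact torsionPowToPrimaryH1_mem_selmerGroupPInfty _ _ _ (conjAct_mem_selmerGroup W hKc τ _ hy)
  set τS : S →+ S := (((isLiftOfAut_liftAut τ).conjH1Primary W 2).comp S.subtype).codRestrict S
    (fun s ↦ hmemS s) with hτSdef
  have hτS_coe : ∀ s : S, ((τS s : S) : galH1Primary (W.baseChange K) 2) =
      (isLiftOfAut_liftAut τ).conjH1Primary W 2 (s : galH1Primary (W.baseChange K) 2) := fun _ ↦ rfl
  have hτS : ∀ s : S, τS (τS s) = s := by
    intro s
    apply Subtype.ext
    obtain ⟨n, y, hy, hys⟩ := hlift s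
    rw [hτS_coe, hτS_coe, ← hys, conjH1Primary_torsionPowToPrimaryH1_conjAct,
      conjH1Primary_torsionPowToPrimaryH1_conjAct, conjAct_conjAct_of_mul_self W hττ]
  -- the maximal divisible subgroup `C = 2^{k₀} S`
  obtain ⟨k₀, hst⟩ := exists_torsionBy_inf_range_stable (A := S) 2
  set C : AddSubgroup S := (nsmulAddMonoidHom (α := S) (2 ^ k₀)).range with hCdef
  have hdivC : ∀ c ∈ C, ∃ c' ∈ C, (2 : ℤ) • c' = c := fun c hc ↦ by
    obtain ⟨n, hn⟩ := hA2 c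
    obtain ⟨c', hc', h⟩ := exists_nsmul_eq_of_stable 2 hst n c hc hn
    exact ⟨c', hc', by rw [two_zsmul, ← two_nsmul, h]⟩
  have hCτ : ∀ c ∈ C, τS c ∈ C := by
    rintro _ ⟨s, rfl⟩
    exact ⟨τS s, by rw [nsmulAddMonoidHom_apply, nsmulAddMonoidHom_apply, map_nsmul]⟩
  have hcorank : 2 ^ (W.baseChange K).selmerCorank 2 = Nat.card ↥(S[((2 : ℕ) : ℤ)] ⊓ C) :=
    pow_zpCorank_eq_natCard_torsionBy_inf_range_of_stable (A := S) 2 hA2 hst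
  -- the eigenframe algebra and the rank count
  obtain ⟨rp, rm, hcardp, hcardm, hframe⟩ := eigenframe_of_divisible_finite_card τS hτS C hCτ hdivC
  haveI : Finite ↥(C ⊓ S[((2 : ℕ) : ℤ)]) :=
    Finite.of_injective (AddSubgroup.inclusion (inf_le_right : C ⊓ S[((2 : ℕ) : ℤ)] ≤ _))
      (AddSubgroup.inclusion_injective _)
  have hprod := natCard_inf_torsionBy_two_eq_mul_of_involution τS hτS C hCτ hdivC
  rw [hcardp, hcardm, inf_comm, ← hcorank, ← pow_add] at hprod
  have hm_eq : (W.baseChange K).selmerCorank 2 = rm + rp := Nat.pow_right_injective le_rfl hprod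
  have hpar := selmerCorank_two_odd_of_twoSelmerParity h14 W hK hH hH2
  rw [hm_eq] at hpar
  have hodd : Odd (rp + rm) := Nat.odd_iff.mpr (by rw [add_comm]; exact hpar)
  have hm0 : 0 < rp + rm := Nat.pos_of_ne_zero fun h ↦ by rw [h] at hodd; exact absurd hodd (by decide)
  -- the data BEFORE `∀ k`
  refine ⟨rp + rm, Fin.append (fun _ : Fin rp ↦ (1 : ℤ)) (fun _ : Fin rm ↦ (-1 : ℤ)), ⟨0, hm0⟩, k₀ + 1, 2, hodd,
    fun i ↦ ?_, fun k hk ↦ ?_⟩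
  · refine Fin.addCases (fun j ↦ ?_) (fun j ↦ ?_) i
    · exact Or.inl (by rw [Fin.append_left])
    · exact Or.inr (by rw [Fin.append_right])
  -- level `2^k`
  obtain ⟨e, f, heC, hfC, heτ, hfτ, hek, hfk, hene, hfne, -, -, hloss, hgen⟩ := hframe k hk
  set x : Fin (rp + rm) → S := Fin.append e f with hxdef
  set sg : Fin (rp + rm) → ℤ := Fin.append (fun _ : Fin rp ↦ (1 : ℤ)) (fun _ : Fin rm ↦ (-1 : ℤ)) with hsgdef
  have hxτ : ∀ i, τS (x i) = sg i • x i := by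
    refine Fin.addCases (fun j ↦ ?_) (fun j ↦ ?_)
    · rw [hxdef, hsgdef, Fin.append_left, Fin.append_left, heτ, one_zsmul]
    · rw [hxdef, hsgdef, Fin.append_right, Fin.append_right, hfτ, neg_one_zsmul]
  have hxk : ∀ i, (2 : ℤ) ^ k • x i = 0 := by
    refine Fin.addCases (fun j ↦ ?_) (fun j ↦ ?_)
    · rw [hxdef, Fin.append_left]; exact hek j
    · rw [hxdef, Fin.append_right]; exact hfk j
  have hxne : ∀ i, (2 : ℤ) ^ (k - 1) • x i ≠ 0 := by
    refine Fin.addCases (fun j ↦ ?_) (fun j ↦ ?_)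
    · rw [hxdef, Fin.append_left]; exact hene j
    · rw [hxdef, Fin.append_right]; exact hfne j
  -- coercions `S → H¹(K, E[2^∞])`
  have coe_sum : ∀ (c : Fin (rp + rm) → ℤ),
      ((∑ i, c i • x i : S) : galH1Primary (W.baseChange K) 2) =
        ∑ i, c i • (x i : galH1Primary (W.baseChange K) 2) := fun c ↦ by
    rw [AddSubmonoidClass.coe_finsetSum]
    exact Finset.sum_congr rfl fun i _ ↦ AddSubgroupClass.coe_zsmul _ _
  -- the frame at level `2^k`: pull back along the dictionary
  have hxk' : ∀ i, (2 ^ k) • (x i : galH1Primary (W.baseChange K) 2) = 0 := fun i ↦ by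
    rw [← AddSubmonoidClass.coe_nsmul, sf_pow_nsmul_eq_zsmul, hxk i, ZeroMemClass.coe_zero]
  choose g hgSel hgx using fun i ↦
    exists_mem_selmerGroup_torsionPowToPrimaryH1_eq (W.baseChange K) 2 k hdiv (x i).2 (hxk' i)
  set T := torsionPowToPrimaryH1 (W.baseChange K) 2 k with hTdef
  have T_sum : ∀ c : Fin (rp + rm) → ℤ, T (∑ i, c i • g i) = ((∑ i, c i • x i : S) : galH1Primary (W.baseChange K) 2) := by
    intro c
    rw [coe_sum, map_sum]
    exact Finset.sum_congr rfl fun i _ ↦ by rw [map_zsmul, hgx]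
  -- relations pull back: `∑ cᵢ gᵢ = 0 ↔ ∑ cᵢ xᵢ = 0`
  have rel_iff : ∀ c : Fin (rp + rm) → ℤ, ∑ i, c i • g i = 0 ↔ ∑ i, c i • x i = 0 := fun c ↦ by
    constructor
    · intro h
      apply Subtype.ext
      rw [← T_sum, h, map_zero, ZeroMemClass.coe_zero]
    · intro h
      apply hinj k
      rw [← hTdef, T_sum, h, map_zero, ZeroMemClass.coe_zero]
  -- LOSS ONE for the appended frame
  have hI : ∀ c : Fin (rp + rm) → ℤ, ∑ i, c i • g i = 0 → ∀ i, (2 : ℤ) ^ (k - 1) ∣ c i := by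
    intro c hc
    rw [rel_iff, hxdef, sf_sum_append'] at hc
    obtain ⟨ha, hb⟩ := hloss _ _ hc
    refine Fin.addCases (fun j ↦ ha j) (fun j ↦ hb j)
  refine ⟨g, fun i ↦ ?_, fun i ↦ ?_, ?_, fun u hu ↦ ?_, fun b hb ↦ ?_⟩
  · -- membership in `H_{𝓕(1)} = Sel^(2^k)(E/K)`
    rw [Jetchev2008.modifiedSelmerGroup_one, ← selmerGroup_eq_selmerGroup_kummerSelmerStructure]
    exact hgSel i
  · -- eigen-signs
    apply hinj k
    rw [← hTdef, map_zsmul, ← conjH1Primary_torsionPowToPrimaryH1_conjAct, ← hTdef, hgx, ← hτS_coe, hxτ,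
      AddSubgroupClass.coe_zsmul]
  · -- exact order `2^k`
    obtain ⟨n, rfl⟩ : ∃ n, k = n + 1 := ⟨k - 1, by omega⟩
    refine addOrderOf_eq_prime_pow (fun h ↦ hxne ⟨0, hm0⟩ ?_) ?_
    · apply Subtype.ext
      rw [Nat.add_sub_cancel, AddSubgroupClass.coe_zsmul, ZeroMemClass.coe_zero, ← sf_pow_nsmul_eq_zsmul, ← hgx,
        ← map_nsmul, h, map_zero]
    · apply hinj (n + 1)
      rw [map_nsmul, map_zero]
      exact pow_nsmul_torsionPowToPrimaryH1 (W.baseChange K) 2 (n + 1) (g ⟨0, hm0⟩)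
  · -- (F3) with `J = k₀ + 1`
    rw [Jetchev2008.modifiedSelmerGroup_one, ← selmerGroup_eq_selmerGroup_kummerSelmerStructure] at hu
    obtain ⟨s, hs⟩ : ∃ s : S, (s : galH1Primary (W.baseChange K) 2) = T u :=
      ⟨⟨T u, torsionPowToPrimaryH1_mem_selmerGroupPInfty _ _ _ hu⟩, rfl⟩
    have hsk : (2 : ℤ) ^ k • s = 0 := Subtype.ext (by
      rw [AddSubgroupClass.coe_zsmul, ZeroMemClass.coe_zero, ← sf_pow_nsmul_eq_zsmul, hs]
      exact pow_nsmul_torsionPowToPrimaryH1 (W.baseChange K) 2 k u)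
    have hcC : (2 ^ k₀) • s ∈ C := ⟨s, rfl⟩
    have hck : (2 : ℤ) ^ k • ((2 ^ k₀) • s) = 0 := by rw [smul_comm, hsk, smul_zero]
    obtain ⟨a, b, hab⟩ := hgen _ hcC hck
    refine ⟨Fin.append a b, fun ρ hρ ↦ ?_⟩
    have hrel : ((2 : ℤ) ^ (k₀ + 1)) • u = ∑ i, Fin.append a b i • g i := by
      apply hinj k
      rw [← hTdef, T_sum, hxdef, sf_sum_append, ← hab, map_zsmul, sf_pow_nsmul_eq_zsmul, smul_smul, ← pow_succ',
        AddSubgroupClass.coe_zsmul, hs]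
    rw [hrel, sub_self]
    have h0 := res_sub W k 0 0 hρ
    rwa [sub_zero, sub_self] at h0
  · -- (F4) with `d = 2`: loss one + Sah at `2`
    intro i
    have h2 : (2 : ℤ) • ∑ i, b i • g i = 0 := two_zsmul_eq_zero_of_res_eq_zero W hK (hsur (k + 1)) hb
    rw [zsmul_finset_sum] at h2
    simp_rw [zsmul_zsmul_eq_mul_zsmul] at h2
    have hdvd := hI (fun i ↦ 2 * b i) h2 i
    by_cases hk2 : 2 ≤ k
    · have e2 : (2 : ℤ) ^ (k - 1) = 2 * 2 ^ (k - 2) := by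
        rw [← pow_succ']; congr 1; omega
      rw [e2] at hdvd
      exact (mul_dvd_mul_iff_left two_ne_zero).1 hdvd
    · have e0 : k - 2 = 0 := by omega
      rw [e0, pow_zero]
      exact one_dvd _

end Summit.BirchSwinnertonDyer.BirchSwinnertonDyer.Theorems.KolyvaginAtTwo.RegularWalk

end
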